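import Summits.HodgeConjecture.HodgeConjecture.Theses.VHCAbelianSchemesRoad

/-!
# Route `VHCAbelianSchemesRoad` (road №4) — the GLUE item stmt-HodgeConjecture-26513
# `SemiregularSheafRepresentativesTwPrimeAtDiagLocalGlue`

research route conditional on HC_CM; not a corollary; Q11.4-sentence-2 already refuted in dim ≥ 3.

The route file (rev 27, director-hodge g12 R12.6 (α)) splits the deciding crux stmt-HodgeConjecture-23176
`SemiregularSheafRepresentativesTwPrimeAtDiagLocal` into the displayed conditional print input
`MarkmanPinnedForallTwPrime` (stmt-HodgeConjecture-26511, `∀ C, Markman2025_secantQuotient_twistedCarrier_onJacobian_pinnedForall C AdmTw′`)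
and the live crux `DiagLocalOfMarkmanPinnedForall` (stmt-HodgeConjecture-26512), whose statement is LITERALLY
`(∀ C, Markman2025_…_pinnedForall C AdmTw′) → SemiregularSheafRepresentativesTwPrimeAtDiagLocal`. The glue item is
`MarkmanPinnedForallTwPrime → DiagLocalOfMarkmanPinnedForall → SemiregularSheafRepresentativesTwPrimeAtDiagLocal`: modus ponens,
the antecedent of the second child being the first child verbatim (refuter note 2026-08-28 on the item: `Iff.rfl` probe, candidate
`fun h₁ h₂ => h₂ h₁`). Pure logic over the route file; no other import, no named-fact hypothesis, no `sorry`. Nothing here says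
either child, the parent crux, `HC_AV` or `HC` holds.
-/

-- the mandated namespace repeats the summit name (single-problem summit); restated so stand-alone elaboration is warning-free
set_option linter.dupNamespace false

namespace Summit.HodgeConjecture.HodgeConjecture.Theorems

/-- **Item stmt-HodgeConjecture-26513 (`SemiregularSheafRepresentativesTwPrimeAtDiagLocalGlue`), route `VHCAbelianSchemesRoad`** —
children ⟹ parent: the live child `DiagLocalOfMarkmanPinnedForall` is by definition an implication whose hypothesis is the displayed
print input `MarkmanPinnedForallTwPrime` verbatim, so the parent `SemiregularSheafRepresentativesTwPrimeAtDiagLocal` follows by modus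
ponens. [cite: Markman2025SecantWeil, Thm. 1.4.1 item 4 and Thm. 1.5.1 (the displayed input only; nothing of it is used or asserted)] -/
theorem vhcAbelianSchemesRoad_twPrimeAtDiagLocalGlue_proof :
    Summit.HodgeConjecture.HodgeConjecture.Theses.VHCAbelianSchemesRoad.SemiregularSheafRepresentativesTwPrimeAtDiagLocalGlue :=
  fun h₁ h₂ ↦ h₂ h₁

end Summit.HodgeConjecture.HodgeConjecture.Theorems
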